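import Summits.AtomisticToContinuum.FouriersLaw.Theses.MatthiessenLadder
import Literature.MathematicalPhysics.KineticTheory.SiteChainQuarticDissipation
import Literature.MathematicalPhysics.KineticTheory.CellChainLangevin
import HarnessLib

/-!
# CEHR Prop. 5.14 for the limit cell block of the prefix rung (registered stub `stub_prefixLimitDissipation`)

Helper for crux `PrefixSteadyStates` (route `MatthiessenLadder`, item stmt-AtomisticToContinuum-12778,
registered stub `stub_prefixLimitDissipation` of the line `registered`, skeleton r12). At energy
`K⁴ → ∞`, in the interaction scaling `q/K, p/K², σ = Kt` of Cuneo–Eckmann–Hairer–Rey-Bellet 2018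
§5.1, the cell block `[0, k]` of the prefix rung `cellChain ω₂ lam β γ (· < k)` converges to the
frictionless, bath-less `(k+1)`-site chain

  `P₀ = { U := fun i q => (if i < k then lam else 0) * q ^ 4 / 4, V := fun _ r => β * r ^ 4 / 4, γ := 0 }`

(quartic pinning on the sites `< k`, none on the interface site `k`, quartic bonds). The stub is the
uniform dissipation bound of CEHR Prop. 5.14 for `P₀`, flow-free: some `ε₁ > 0` bounds
`∫₀^Λ p̂₀(s)² ds` below for every continuous classical solution of `y' = P₀.langevinDrift (k+1) (y t)`
on `(0, Λ)` started in the shell `h₁ ≤ Ĥ ≤ h₀` (`h₁ > 0`). It is the instance `a i = [i < k] lam`,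
`N = k + 1` (site `0` is pinned since `k ≥ 1`) of the Literature theorem
`SiteChain.quartic_exists_dissipation_lower_bound` (`SiteChainQuarticDissipation.lean`: unique
continuation along the quartic bonds from the left bath site + Euler's identity for positivity,
uniqueness and joint continuity of the truncated Hamiltonian flow of `SiteChainHamiltonianFlow.lean`
and compactness of the shell for uniformity).
-/

noncomputable section

open MeasureTheory Filter Topology Set
open scoped NNReal ENNReal

namespace Summit.AtomisticToContinuum.FouriersLaw.Theorems.PrefixSteadyStates.LineRegistered

open Literature.MathematicalPhysics.KineticTheory.HeatConduction
open Literature.MathematicalPhysics.KineticTheory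

/-- **Registered stub `stub_prefixLimitDissipation` of crux `PrefixSteadyStates` (line `registered`)
— CEHR Prop. 5.14 for the LIMIT CELL BLOCK of the mixed rung**: for `lam, β > 0`, `k ≥ 1`,
`0 < h₁ ≤ h₀` and `Λ > 0` there is `ε₁ > 0` such that every continuous solution `y` of the
Hamiltonian equations of the frictionless `(k+1)`-site quartic chain (pinning `lam q⁴/4` on the sites
`i < k`, none on site `k`, bonds `β r⁴/4`) on `(0, Λ)`, started in the shell `h₁ ≤ Ĥ ≤ h₀`,
dissipates `∫₀^Λ p̂₀(s)² ds ≥ ε₁` at the left bath site; by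
`SiteChain.quartic_exists_dissipation_lower_bound` with `a i = [i < k] lam`.
[cite: CuneoEckmannHairerReyBellet2018, Prop 5.14] -/
theorem stub_prefixLimitDissipation :
    ∀ lam β : ℝ, 0 < lam → 0 < β → ∀ k : ℕ, 0 < k → ∀ h₁ h₀ Λ : ℝ, 0 < h₁ → h₁ ≤ h₀ → 0 < Λ →
      ∃ ε₁ : ℝ, 0 < ε₁ ∧
        ∀ (x : PhaseSpace (k + 1)) (y : ℝ → PhaseSpace (k + 1)),
          h₁ ≤ SiteChain.hamiltonian
              ({ U := fun i q => (if i < k then lam else 0) * q ^ 4 / 4, V := fun _ r => β * r ^ 4 / 4,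
                 γ := 0 } : SiteChain) (k + 1) x →
          SiteChain.hamiltonian
              ({ U := fun i q => (if i < k then lam else 0) * q ^ 4 / 4, V := fun _ r => β * r ^ 4 / 4,
                 γ := 0 } : SiteChain) (k + 1) x ≤ h₀ →
          Continuous y → y 0 = x →
          (∀ t ∈ Set.Ioo (0 : ℝ) Λ,
            HasDerivAt y
              (SiteChain.langevinDrift
                ({ U := fun i q => (if i < k then lam else 0) * q ^ 4 / 4, V := fun _ r => β * r ^ 4 / 4,
                   γ := 0 } : SiteChain) (k + 1) (y t)) t) →
          ε₁ ≤ ∫ s in (0 : ℝ)..Λ, (y s).2 ⟨0, Nat.succ_pos k⟩ ^ 2 := by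
  intro lam β hlam hβ k hk h₁ h₀ Λ hh₁ _ hΛ
  exact @SiteChain.quartic_exists_dissipation_lower_bound (k + 1)
    ⟨fun i q => (if i < k then lam else 0) * q ^ 4 / 4, fun _ r => β * r ^ 4 / 4, 0⟩
    (fun i => if i < k then lam else 0) β (fun _ _ => rfl) (fun _ _ => rfl) rfl
    (fun i => by by_cases hi : i < k <;> simp [hi, hlam.le]) (by rw [if_pos hk]; exact hlam) hβ
    (Nat.succ_pos k) h₁ h₀ Λ hh₁ hΛ

end Summit.AtomisticToContinuum.FouriersLaw.Theorems.PrefixSteadyStates.LineRegistered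

end
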